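import Literature.NumberTheory.Sieve.MaynardSieveTupleS1
import HarnessLib

/-!
# Maynard–Tao sieve: Lemmas 5.2 and 5.3 (the sums `S₂^{(m)}`), combinatorial part

J. Maynard, *Small gaps between primes*, Ann. of Math. (2) 181 (2015), 383–413 = arXiv:1311.4600,
Lemma 5.2: `S₂^{(m)} = (X_N/φ(W)) ∑'_{d,e: d_m=e_m=1} λ_dλ_e/∏φ([dᵢ,eᵢ]) + O(∑ |λ_dλ_e| E(N, q))`
followed by the diagonalisation in the variables `y^{(m)}`, and Lemma 5.3:
`y^{(m)}_r = ∑_a y_{r_1,…,a,…,r_k}/φ(a) + O(y_max φ(W) log R/(W D₀))`.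

This file proves the combinatorial content of these two lemmas for the pair encoding of
`MaynardSieveTuples` (continuing `MaynardSieveTupleS1`; fixed `D₀`, every use of `D₀ → ∞` kept as an
explicit `O(1/D₀)`), but organised differently from the printed proof: the variables `y^{(m)}` and
Lemma 5.3 are bypassed — after the prime-by-prime factorisation of the kernel (`MaynardSieveKernel`)
the main term appears directly as a sum over *good pairs* (`r, r'` equal off the index `m`), which is
the `(k+1)`-dimensional sum of the proof of Lemma 6.3. (The tree's other route,
`MaynardSieveBilinear.lean`/`MaynardSieveWeightsM.lean`, follows the printed `y^{(m)}` path.)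

* `S2Setup`: `S₂^{(m)}`, the restriction to `d_m = e_m = 1` (`sieveTerm_eq_sum_tuplesOff`: a prime
  `p ≤ R` cannot divide the prime `n + h_m > R`), the expansion `S2_eq_sum_cnt2` ((5.17)), the
  vanishing of incompatible pairs, and the structural identity `S2_eq_main_add_err`:
  `S₂^{(m)} = (X/φ(W)) Σ'₂ + ∑' λ_d λ_e E(d,e)` with `E(d, e) = #{…, n + h_m prime} − X/φ(W q)`
  (`err2`; the prime-counting discrepancy, estimated in the analytic part from the level of
  distribution);
* `S2Kernel`: `Σ'₂ = ∑_{A,A'} y_A y_{A'} K₂(A∖m, A'∖m)/(φ(A)φ(A'))` with the kernel of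
  `MaynardSieveKernel` for `d(p) = p − 1` on the off-parts (`mainSum2_eq_sum_kernel`, the
  substitution of (5.8) into (5.20)–(5.23)), the local weights `locW2`, and the bound
  `locW2 ≤ 3/(p−1)²` at every prime whose local configuration is not one of the three "good" ones
  (same index `≠ m` in both tuples; index `m` in one tuple and absent from the other) —
  these are Maynard's error configurations `s_{i,j} > D₀` of (5.22) and `a_j ≠ r_j` of (5.26);
* `S2Peel`: peeling the least bad prime (removing it from both tuples leaves the other local data
  unchanged, `locW2_dropPrime`), whence `sum_W2_bad_le`: for `D₀ ≥ 24(k+1)²` the bad pairs weigh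
  at most `(24(k+1)²/D₀) ×` the good ones;
* `S2Good`: good pairs are exactly "equal off-parts, disjoint `m`-parts" (`not_badPair_iff`, the
  main term `a_j = r_j (j ≠ m)` of Lemma 5.3 with the two free variables `r_m`, `s_m`), on them
  `K₂/(φφ') = ∏_{p ∣ r, off m} (p²−p−1)/(p−1)³ · ∏_{p ∣ r_m} 1/(p−1) · ∏_{p ∣ s_m} 1/(p−1)`
  (`kernel_div_eq_goodW`, the weights `γ` of (6.10) and (6.13)), and the conclusion
  `abs_mainSum2_sub_good_le`:
  `|Σ'₂ − ∑_{good} y_A y_{A'} goodW(A,A')| ≤ y_max² (24(k+1)²/D₀) ∑_{good} goodW`.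

## References

* J. Maynard, *Small gaps between primes*, Ann. of Math. (2) 181 (2015), 383–413,
  doi:10.4007/annals.2015.181.1.7 = arXiv:1311.4600; Lemmas 5.2, 5.3 and their proofs,
  (5.16)–(5.27), and the weights of (6.10)–(6.14). [cite: MaynardAnnals2015]
-/

open Finset

namespace Literature.NumberTheory.Sieve
namespace MaynardTao


/-! ### The sum `S₂^{(m)}`: set-up and the Chinese remainder step (Lemma 5.2, first part) -/

section S2Setup

variable {k : ℕ} {D₀ Rn N : ℕ} {h : Fin k → ℤ} {v₀ : ℤ}

/-- "`n + h_m` is a (positive, rational) prime", the indicator `χ_ℙ(n + h_m)` of Maynard's `S₂^{(m)}`.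
[cite: MaynardAnnals2015, (5.16)] -/
def IsPrimeAt (h : Fin k → ℤ) (m : Fin k) (n : ℤ) : Prop := 0 < n + h m ∧ (n + h m).toNat.Prime

/-- Decidability. [folklore] -/
instance (h : Fin k → ℤ) (m : Fin k) (n : ℤ) : Decidable (IsPrimeAt h m n) := by
  unfold IsPrimeAt; infer_instance

/-- `S₂^{(m)} = ∑_{N ≤ n < 2N, n ≡ v₀ (W)} χ_ℙ(n + h_m) (∑_{dᵢ ∣ n+hᵢ} λ_d)²` (Maynard 2015, (5.16)).
[cite: MaynardAnnals2015, (5.16)] -/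
noncomputable def S2 (D₀ Rn W N : ℕ) (v₀ : ℤ) (y : Finset (ℕ × Fin k) → ℝ) (h : Fin k → ℤ)
    (m : Fin k) : ℝ :=
  ∑ n ∈ sieveRange W N v₀, (if IsPrimeAt h m n then 1 else 0) * sieveTerm D₀ Rn y h n ^ 2

/-- The divisor tuples with `d_m = 1`: no pair of index `m`. [cite: MaynardAnnals2015, proof of Lemma 5.2] -/
noncomputable def tuplesOff (k D₀ Rn : ℕ) (m : Fin k) : Finset (Finset (ℕ × Fin k)) :=
  (tuplesProd k D₀ Rn).filter (fun B => ∀ x ∈ B, x.2 ≠ m)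

/-- Membership in `tuplesOff`. [folklore] -/
theorem mem_tuplesOff {m : Fin k} {B : Finset (ℕ × Fin k)} :
    B ∈ tuplesOff k D₀ Rn m ↔ B ∈ tuplesProd k D₀ Rn ∧ ∀ x ∈ B, x.2 ≠ m := Finset.mem_filter

/-- **Only `d_m = e_m = 1` contribute** (Maynard 2015, proof of Lemma 5.2: "The integer `n + h_m`
will lie in a residue class coprime to the modulus if and only if `d_m = e_m = 1`"): if `n + h_m`
is a prime exceeding `R` then no divisor tuple with a pair of index `m` divides. [cite: MaynardAnnals2015, proof of Lemma 5.2] -/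
theorem not_divides_of_isPrimeAt {m : Fin k} {n : ℤ} (hn : IsPrimeAt h m n) (hR : (Rn : ℤ) < n + h m)
    {B : Finset (ℕ × Fin k)} (hB : B ∈ tuplesProd k D₀ Rn) (hx : ∃ x ∈ B, x.2 = m) :
    ¬Divides h B n := by
  intro hd
  obtain ⟨x, hxB, hxm⟩ := hx
  have hp : x.1.Prime := prime_of_mem_tuples (tuplesProd_subset hB) hxB
  have hle : x.1 ≤ Rn := (mem_primesIoc.1 ((mem_tuples.1 (tuplesProd_subset hB)).1 x hxB)).1.2
  have hdvd := hd x hxB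
  rw [hxm] at hdvd
  obtain ⟨hpos, hprime⟩ := hn
  set q := (n + h m).toNat with hq
  have hq' : (q : ℤ) = n + h m := Int.toNat_of_nonneg hpos.le
  rw [← hq'] at hdvd hR
  have hdvd' : x.1 ∣ q := by exact_mod_cast hdvd
  have := (Nat.prime_dvd_prime_iff_eq hp hprime).1 hdvd'
  rw [this] at hle
  omega

/-- For `n` with `n + h_m` a prime `> R`, the sieve term only sees tuples with `d_m = 1`.
[cite: MaynardAnnals2015, proof of Lemma 5.2] -/
theorem sieveTerm_eq_sum_tuplesOff {m : Fin k} {n : ℤ} (hn : IsPrimeAt h m n) (hR : (Rn : ℤ) < n + h m)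
    (y : Finset (ℕ × Fin k) → ℝ) :
    sieveTerm D₀ Rn y h n = ∑ B ∈ tuplesOff k D₀ Rn m, if Divides h B n then lam D₀ Rn y B else 0 := by
  rw [sieveTerm, tuplesOff, Finset.sum_filter]
  refine Finset.sum_congr rfl fun B hB => ?_
  by_cases hx : ∀ x ∈ B, x.2 ≠ m
  · rw [if_pos hx]
  · rw [if_neg hx, if_neg]
    push Not at hx
    exact not_divides_of_isPrimeAt hn hR hB hx

/-- The count of Lemma 5.2: `#{N ≤ n < 2N : n ≡ v₀ (W), d, e ∣ n + h, n + h_m prime}`.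
[cite: MaynardAnnals2015, proof of Lemma 5.2, (5.17)] -/
noncomputable def cnt2 (W N : ℕ) (v₀ : ℤ) (h : Fin k → ℤ) (m : Fin k) (B C : Finset (ℕ × Fin k)) : ℕ :=
  ((sieveRange W N v₀).filter (fun n => IsPrimeAt h m n ∧ (Divides h B n ∧ Divides h C n))).card

/-- **Expansion of `S₂^{(m)}`** (Maynard 2015, (5.17)), valid as soon as `N + h_m > R`:
`S₂^{(m)} = ∑_{d, e with d_m = e_m = 1} λ_d λ_e #{n : [dᵢ,eᵢ] ∣ n + hᵢ, n + h_m prime}`.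
[cite: MaynardAnnals2015, proof of Lemma 5.2, (5.17)] -/
theorem S2_eq_sum_cnt2 (m : Fin k) (hR : (Rn : ℤ) < N + h m) (y : Finset (ℕ × Fin k) → ℝ) :
    S2 D₀ Rn (primorial D₀) N v₀ y h m = ∑ B ∈ tuplesOff k D₀ Rn m, ∑ C ∈ tuplesOff k D₀ Rn m,
      lam D₀ Rn y B * lam D₀ Rn y C * (cnt2 (primorial D₀) N v₀ h m B C : ℝ) := by
  set Tm := tuplesOff k D₀ Rn m with hTm
  set rng := sieveRange (primorial D₀) N v₀
  -- replace the sieve term by its restriction to `d_m = 1` on the support of `χ_ℙ`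
  have hterm : ∀ n ∈ rng, (if IsPrimeAt h m n then (1:ℝ) else 0) * sieveTerm D₀ Rn y h n ^ 2 =
      (if IsPrimeAt h m n then (1:ℝ) else 0) *
        (∑ B ∈ Tm, if Divides h B n then lam D₀ Rn y B else 0) ^ 2 := by
    intro n hn
    by_cases hp : IsPrimeAt h m n
    · have hnN : (N : ℤ) ≤ n := (Finset.mem_Ico.1 (Finset.mem_filter.1 hn).1).1
      rw [sieveTerm_eq_sum_tuplesOff hp (by linarith) y]
    · simp [hp]
  unfold S2
  rw [Finset.sum_congr rfl hterm]
  simp_rw [sq, Finset.sum_mul_sum, Finset.mul_sum]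
  rw [Finset.sum_comm]
  refine Finset.sum_congr rfl fun B _ => ?_
  rw [Finset.sum_comm]
  refine Finset.sum_congr rfl fun C _ => ?_
  rw [cnt2, Finset.card_eq_sum_ones, Nat.cast_sum, Finset.mul_sum, Finset.sum_filter]
  refine Finset.sum_congr rfl fun n _ => ?_
  by_cases h0 : IsPrimeAt h m n <;> by_cases h1 : Divides h B n <;> by_cases h2 : Divides h C n <;>
    simp [h0, h1, h2]

/-- Incompatible pairs do not contribute to `S₂^{(m)}` either. [cite: MaynardAnnals2015, proof of Lemma 5.2] -/
theorem cnt2_eq_zero_of_not_isFunctional (hh : ShiftHyp k D₀ h) {m : Fin k} {B C : Finset (ℕ × Fin k)}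
    (hB : B ∈ tuplesProd k D₀ Rn) (hC : C ∈ tuplesProd k D₀ Rn) (hBC : ¬IsFunctional (B ∪ C)) :
    cnt2 (primorial D₀) N v₀ h m B C = 0 := by
  rw [cnt2, Finset.card_eq_zero, Finset.filter_eq_empty_iff]
  intro n _ hn
  exact not_divides_of_not_isFunctional hh hB hC hBC n hn.2

/-- The main-term double sum of Lemma 5.2 after the Chinese remainder theorem:
`Σ'₂ = ∑'_{d, e, d_m = e_m = 1} λ_d λ_e / ∏ᵢ φ([dᵢ, eᵢ])` (Maynard 2015, (5.20), main term).
[cite: MaynardAnnals2015, proof of Lemma 5.2, (5.20)] -/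
noncomputable def mainSum2 (D₀ Rn : ℕ) (y : Finset (ℕ × Fin k) → ℝ) (m : Fin k) : ℝ :=
  ∑ B ∈ tuplesOff k D₀ Rn m, ∑ C ∈ tuplesOff k D₀ Rn m,
    if IsFunctional (B ∪ C) then
      lam D₀ Rn y B * lam D₀ Rn y C / ∏ p ∈ (B ∪ C).image Prod.fst, ((p : ℝ) - 1)
    else 0

/-- The error functional of Lemma 5.2: the discrepancy of the prime count in the residue class of
the compatible pair `(d, e)` from `X/φ(q)` (Maynard's `E(N, q)` at our residue, (5.18)).
[cite: MaynardAnnals2015, proof of Lemma 5.2, (5.18)] -/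
noncomputable def err2 (D₀ N : ℕ) (v₀ : ℤ) (h : Fin k → ℤ) (m : Fin k) (X : ℝ) (B C : Finset (ℕ × Fin k)) : ℝ :=
  (cnt2 (primorial D₀) N v₀ h m B C : ℝ) -
    X / ((Nat.totient (primorial D₀) : ℝ) * ∏ p ∈ (B ∪ C).image Prod.fst, ((p : ℝ) - 1))

/-- **Lemma 5.2, first step** (Maynard 2015, (5.20)): for `N + h_m > R`,
`S₂^{(m)} = (X/φ(W)) Σ'₂ + ∑'_{d,e} λ_d λ_e E(d, e)`, where `X` is any real number (in the
application the number of primes in `[N + h_m, 2N + h_m)`) and `E` the discrepancy `err2`.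
[cite: MaynardAnnals2015, Lemma 5.2, (5.17)–(5.20)] -/
theorem S2_eq_main_add_err (hh : ShiftHyp k D₀ h) (m : Fin k) (hR : (Rn : ℤ) < N + h m)
    (y : Finset (ℕ × Fin k) → ℝ) (X : ℝ) :
    S2 D₀ Rn (primorial D₀) N v₀ y h m =
      X / (Nat.totient (primorial D₀) : ℝ) * mainSum2 D₀ Rn y m +
      ∑ B ∈ tuplesOff k D₀ Rn m, ∑ C ∈ tuplesOff k D₀ Rn m,
        if IsFunctional (B ∪ C) then lam D₀ Rn y B * lam D₀ Rn y C * err2 D₀ N v₀ h m X B C else 0 := by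
  rw [S2_eq_sum_cnt2 m hR y, mainSum2, Finset.mul_sum, ← Finset.sum_add_distrib]
  refine Finset.sum_congr rfl fun B hB => ?_
  rw [Finset.mul_sum, ← Finset.sum_add_distrib]
  refine Finset.sum_congr rfl fun C hC => ?_
  by_cases hf : IsFunctional (B ∪ C)
  · rw [if_pos hf, if_pos hf, err2]
    ring
  · rw [if_neg hf, if_neg hf, cnt2_eq_zero_of_not_isFunctional hh (mem_tuplesOff.1 hB).1
      (mem_tuplesOff.1 hC).1 hf]
    simp

end S2Setup


/-! ### Lemma 5.2/5.3: the quadratic form for `S₂^{(m)}` and its local weights -/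

section S2Kernel

variable {k : ℕ} {D₀ Rn : ℕ}

/-- The part of a tuple off the index `m` (`r` with `r_m` replaced by `1`). [folklore] -/
def offPart (A : Finset (ℕ × Fin k)) (m : Fin k) : Finset (ℕ × Fin k) := A.filter (fun x => x.2 ≠ m)

/-- The `m`-part of a tuple (the pairs of index `m`, i.e. the prime factors of `r_m`). [folklore] -/
def mPart (A : Finset (ℕ × Fin k)) (m : Fin k) : Finset (ℕ × Fin k) := A.filter (fun x => x.2 = m)

/-- `A∖m ⊆ A`. [folklore] -/
theorem offPart_subset (A : Finset (ℕ × Fin k)) (m : Fin k) : offPart A m ⊆ A := Finset.filter_subset _ _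
/-- `A_m ⊆ A`. [folklore] -/
theorem mPart_subset (A : Finset (ℕ × Fin k)) (m : Fin k) : mPart A m ⊆ A := Finset.filter_subset _ _

/-- Membership in the off-part. [folklore] -/
theorem mem_offPart {A : Finset (ℕ × Fin k)} {m : Fin k} {x : ℕ × Fin k} :
    x ∈ offPart A m ↔ x ∈ A ∧ x.2 ≠ m := Finset.mem_filter

/-- Membership in the `m`-part. [folklore] -/
theorem mem_mPart {A : Finset (ℕ × Fin k)} {m : Fin k} {x : ℕ × Fin k} :
    x ∈ mPart A m ↔ x ∈ A ∧ x.2 = m := Finset.mem_filter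

/-- `A = A∖m ∪ A_m`. [folklore] -/
theorem offPart_union_mPart (A : Finset (ℕ × Fin k)) (m : Fin k) : offPart A m ∪ mPart A m = A := by
  rw [offPart, mPart, Finset.union_comm]; exact Finset.filter_union_filter_not_eq _ A

/-- `A∖m` and `A_m` are disjoint. [folklore] -/
theorem disjoint_offPart_mPart (A : Finset (ℕ × Fin k)) (m : Fin k) : Disjoint (offPart A m) (mPart A m) :=
  Finset.disjoint_left.2 fun _ h1 h2 => (mem_offPart.1 h1).2 (mem_mPart.1 h2).2

/-- Divisor tuples with `d_m = 1` below `A` are the sub-finsets of its off-part. [folklore] -/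
theorem sum_tuplesOff_sum_superset (m : Fin k) (F : Finset (ℕ × Fin k) → Finset (ℕ × Fin k) → ℝ) :
    ∑ B ∈ tuplesOff k D₀ Rn m, ∑ A ∈ (tuplesProd k D₀ Rn).filter (fun A => B ⊆ A), F B A =
      ∑ A ∈ tuplesProd k D₀ Rn, ∑ B ∈ (offPart A m).powerset, F B A := by
  refine Finset.sum_comm' fun B A => ?_
  rw [Finset.mem_filter, Finset.mem_powerset, mem_tuplesOff]
  constructor
  · rintro ⟨⟨-, hBm⟩, hA, hBA⟩
    exact ⟨fun x hx => mem_offPart.2 ⟨hBA hx, hBm x hx⟩, hA⟩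
  · rintro ⟨hB, hA⟩
    have hBA : B ⊆ A := hB.trans (offPart_subset A m)
    exact ⟨⟨subset_mem_tuplesProd hA hBA, fun x hx => (mem_offPart.1 (hB hx)).2⟩, hA, hBA⟩

/-- **The quadratic form for `S₂^{(m)}`** (Maynard 2015, (5.20)–(5.23) with (5.8) substituted):
`Σ'₂ = ∑_{A,A'} y_A y_{A'} K₂(A∖m, A'∖m)/(φ(A)φ(A'))` with the kernel for `d(p) = p − 1` evaluated
on the off-parts. [cite: MaynardAnnals2015, proof of Lemma 5.2, (5.20)–(5.23)] -/
theorem mainSum2_eq_sum_kernel (y : Finset (ℕ × Fin k) → ℝ) (m : Fin k) :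
    mainSum2 D₀ Rn y m = ∑ A ∈ tuplesProd k D₀ Rn, ∑ A' ∈ tuplesProd k D₀ Rn,
      y A * y A' / (phiA A * phiA A') * kernel (fun p => (p : ℝ) - 1) (offPart A m) (offPart A' m) := by
  set T := tuplesProd k D₀ Rn with hT
  set Tm := tuplesOff k D₀ Rn m with hTm
  have step1 : mainSum2 D₀ Rn y m = ∑ B ∈ Tm, ∑ C ∈ Tm, ∑ A ∈ T.filter (fun A => B ⊆ A),
      ∑ A' ∈ T.filter (fun A' => C ⊆ A'),
        (if IsFunctional (B ∪ C) then
          (-1 : ℝ) ^ B.card * (-1 : ℝ) ^ C.card * (prodA B * prodA C) /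
            ∏ p ∈ (B ∪ C).image Prod.fst, ((p : ℝ) - 1) else 0) * (y A / phiA A * (y A' / phiA A')) := by
    unfold mainSum2
    rw [← hTm]
    refine Finset.sum_congr rfl fun B _ => Finset.sum_congr rfl fun C _ => ?_
    split_ifs with hf
    · unfold lam
      rw [← hT]
      simp_rw [← Finset.mul_sum]
      rw [← Finset.sum_mul]
      ring
    · simp
  have step2 : ∑ B ∈ Tm, ∑ C ∈ Tm, ∑ A ∈ T.filter (fun A => B ⊆ A),
      ∑ A' ∈ T.filter (fun A' => C ⊆ A'),
        (if IsFunctional (B ∪ C) then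
          (-1 : ℝ) ^ B.card * (-1 : ℝ) ^ C.card * (prodA B * prodA C) /
            ∏ p ∈ (B ∪ C).image Prod.fst, ((p : ℝ) - 1) else 0) * (y A / phiA A * (y A' / phiA A')) =
      ∑ A ∈ T, ∑ A' ∈ T, ∑ B ∈ (offPart A m).powerset, ∑ C ∈ (offPart A' m).powerset,
        (if IsFunctional (B ∪ C) then
          (-1 : ℝ) ^ B.card * (-1 : ℝ) ^ C.card * (prodA B * prodA C) /
            ∏ p ∈ (B ∪ C).image Prod.fst, ((p : ℝ) - 1) else 0) * (y A / phiA A * (y A' / phiA A')) := by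
    have e1 : ∀ B ∈ Tm, ∑ C ∈ Tm, ∑ A ∈ T.filter (fun A => B ⊆ A),
        ∑ A' ∈ T.filter (fun A' => C ⊆ A'),
          (if IsFunctional (B ∪ C) then
            (-1 : ℝ) ^ B.card * (-1 : ℝ) ^ C.card * (prodA B * prodA C) /
              ∏ p ∈ (B ∪ C).image Prod.fst, ((p : ℝ) - 1) else 0) * (y A / phiA A * (y A' / phiA A')) =
        ∑ A ∈ T.filter (fun A => B ⊆ A), ∑ A' ∈ T, ∑ C ∈ (offPart A' m).powerset,
          (if IsFunctional (B ∪ C) then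
            (-1 : ℝ) ^ B.card * (-1 : ℝ) ^ C.card * (prodA B * prodA C) /
              ∏ p ∈ (B ∪ C).image Prod.fst, ((p : ℝ) - 1) else 0) * (y A / phiA A * (y A' / phiA A')) := by
      intro B _
      rw [Finset.sum_comm]
      refine Finset.sum_congr rfl fun A _ => ?_
      exact sum_tuplesOff_sum_superset m _
    rw [Finset.sum_congr rfl e1, hTm, hT, sum_tuplesOff_sum_superset]
    refine Finset.sum_congr rfl fun A _ => ?_
    rw [Finset.sum_comm]
  rw [step1, step2]
  refine Finset.sum_congr rfl fun A _ => Finset.sum_congr rfl fun A' _ => ?_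
  rw [kernel, Finset.mul_sum]
  refine Finset.sum_congr rfl fun B _ => ?_
  rw [Finset.mul_sum]
  refine Finset.sum_congr rfl fun C _ => ?_
  unfold prodA
  split_ifs <;> ring

/-! #### Local weights -/

variable (m : Fin k)

/-- The full local weight of a pair `(A, A')` at the prime `p` (kernel factor on the off-parts
divided by the `φ`-factors of `A` and `A'`), in absolute value. [cite: MaynardAnnals2015, proof of Lemma 5.3, (5.26)–(5.27)] -/
noncomputable def locW2 (P : Finset (ℕ × Fin k) × Finset (ℕ × Fin k)) (p : ℕ) : ℝ :=
  |(if p ∈ (offPart P.1 m ∪ offPart P.2 m).image Prod.fst then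
      kernelLoc (fun p => (p : ℝ) - 1) (offPart P.1 m) (offPart P.2 m) p else 1)| /
    ((if p ∈ P.1.image Prod.fst then ((p : ℝ) - 1) else 1) *
      (if p ∈ P.2.image Prod.fst then ((p : ℝ) - 1) else 1))

/-- A prime is *good* for the pair `(A, A')` if it carries the same index `≠ m` in both, or the
index `m` in one and does not occur in the other (Maynard: `a_j = r_j` for `j ≠ m`, and the
variable `u` of (6.10)). [cite: MaynardAnnals2015, proof of Lemma 5.3] -/
def GoodPrime (P : Finset (ℕ × Fin k) × Finset (ℕ × Fin k)) (p : ℕ) : Prop :=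
  p ∈ (offPart P.1 m ∩ offPart P.2 m).image Prod.fst ∨
    (p ∈ (mPart P.1 m).image Prod.fst ∧ p ∉ P.2.image Prod.fst) ∨
    (p ∈ (mPart P.2 m).image Prod.fst ∧ p ∉ P.1.image Prod.fst)

/-- Decidability. [folklore] -/
instance (P : Finset (ℕ × Fin k) × Finset (ℕ × Fin k)) (p : ℕ) : Decidable (GoodPrime m P p) := by
  unfold GoodPrime; infer_instance

/-- The primes of `A` are those of `A∖m` and of `A_m`. [folklore] -/
theorem image_fst_offPart_union_mPart (A : Finset (ℕ × Fin k)) :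
    (offPart A m).image Prod.fst ∪ (mPart A m).image Prod.fst = A.image Prod.fst := by
  rw [← Finset.image_union, offPart_union_mPart]

/-- A prime of `A∖m` is not a prime of `A_m`. [folklore] -/
theorem not_mem_mPart_of_mem_offPart {A : Finset (ℕ × Fin k)} (hA : IsFunctional A) {p : ℕ}
    (hp : p ∈ (offPart A m).image Prod.fst) : p ∉ (mPart A m).image Prod.fst := by
  intro hp'
  obtain ⟨x, hx, rfl⟩ := Finset.mem_image.1 hp
  obtain ⟨y, hy, hyx⟩ := Finset.mem_image.1 hp'
  have := hA x (offPart_subset A m hx) y (mPart_subset A m hy) hyx.symm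
  subst this
  exact (mem_offPart.1 hx).2 (mem_mPart.1 hy).2

/-- **Bad primes have weight `≤ 3/(p−1)²`** (the factors `μ(s)²/g(s)²`, `μ(a_j)²/φ(a_j)²` of
Maynard's (5.22), (5.26)). [cite: MaynardAnnals2015, proof of Lemmas 5.2–5.3, (5.22), (5.26)] -/
theorem locW2_le_of_not_good {P : Finset (ℕ × Fin k) × Finset (ℕ × Fin k)}
    (h1 : P.1 ∈ tuplesProd k D₀ Rn) (h2 : P.2 ∈ tuplesProd k D₀ Rn) {p : ℕ}
    (hp : p ∈ (P.1 ∪ P.2).image Prod.fst) (hbad : ¬GoodPrime m P p) :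
    locW2 m P p ≤ 3 / ((p : ℝ) - 1) ^ 2 := by
  have hf1 := isFunctional_of_mem_tuples (tuplesProd_subset h1)
  have hf2 := isFunctional_of_mem_tuples (tuplesProd_subset h2)
  have hpp : p.Prime := by
    obtain ⟨x, hx, rfl⟩ := Finset.mem_image.1 hp
    exact (Finset.mem_union.1 hx).elim (fun h => prime_of_mem_tuples (tuplesProd_subset h1) h)
      (fun h => prime_of_mem_tuples (tuplesProd_subset h2) h)
  have hp2 : (2:ℝ) ≤ p := by exact_mod_cast hpp.two_le
  have hq : 0 < (p:ℝ) - 1 := by linarith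
  -- membership bookkeeping
  have hA : p ∈ P.1.image Prod.fst ↔ p ∈ (offPart P.1 m).image Prod.fst ∨ p ∈ (mPart P.1 m).image Prod.fst := by
    rw [← Finset.mem_union, image_fst_offPart_union_mPart]
  have hA' : p ∈ P.2.image Prod.fst ↔ p ∈ (offPart P.2 m).image Prod.fst ∨ p ∈ (mPart P.2 m).image Prod.fst := by
    rw [← Finset.mem_union, image_fst_offPart_union_mPart]
  have hSsub : p ∈ (offPart P.1 m ∩ offPart P.2 m).image Prod.fst →
      p ∈ (offPart P.1 m).image Prod.fst ∧ p ∈ (offPart P.2 m).image Prod.fst := by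
    intro h
    obtain ⟨x, hx, rfl⟩ := Finset.mem_image.1 h
    rw [Finset.mem_inter] at hx
    exact ⟨Finset.mem_image.2 ⟨x, hx.1, rfl⟩, Finset.mem_image.2 ⟨x, hx.2, rfl⟩⟩
  unfold GoodPrime at hbad
  push Not at hbad
  obtain ⟨hnS, hnm1, hnm2⟩ := hbad
  unfold locW2 kernelLoc
  have hcond : p ∈ (offPart P.1 m ∪ offPart P.2 m).image Prod.fst ↔
      p ∈ (offPart P.1 m).image Prod.fst ∨ p ∈ (offPart P.2 m).image Prod.fst := by
    rw [Finset.image_union, Finset.mem_union]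
  rw [if_neg hnS]
  by_cases ho1 : p ∈ (offPart P.1 m).image Prod.fst <;>
    by_cases ho2 : p ∈ (offPart P.2 m).image Prod.fst
  · -- both off-parts, different indices: `(p+1)/(p-1)^3`
    have i1 : p ∈ P.1.image Prod.fst := hA.2 (Or.inl ho1)
    have i2 : p ∈ P.2.image Prod.fst := hA'.2 (Or.inl ho2)
    rw [if_pos (hcond.2 (Or.inl ho1)), if_pos ho1, if_pos ho2, if_pos i1, if_pos i2,
      div_le_div_iff₀ (by positivity) (by positivity)]
    have : |1 - (p:ℝ) / ((p:ℝ) - 1) - (p:ℝ) / ((p:ℝ) - 1) + 0| = ((p:ℝ) + 1) / ((p:ℝ) - 1) := by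
      rw [add_zero, show 1 - (p:ℝ) / ((p:ℝ) - 1) - (p:ℝ) / ((p:ℝ) - 1) = -(((p:ℝ) + 1) / ((p:ℝ) - 1)) by
        field_simp; ring, abs_neg, abs_of_pos (by positivity)]
    rw [this, div_mul_eq_mul_div, div_le_iff₀ hq]
    nlinarith
  · -- in `A` off `m`, not in `A'` off `m`
    have i1 : p ∈ P.1.image Prod.fst := hA.2 (Or.inl ho1)
    rw [if_pos (hcond.2 (Or.inl ho1)), if_pos ho1, if_neg ho2, if_pos i1]
    have e : |1 - (p:ℝ) / ((p:ℝ) - 1) - 0 + 0| = 1 / ((p:ℝ) - 1) := by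
      rw [sub_zero, add_zero, show 1 - (p:ℝ) / ((p:ℝ) - 1) = -(1 / ((p:ℝ) - 1)) by field_simp; ring,
        abs_neg, abs_of_pos (by positivity)]
    rw [e]
    by_cases i2 : p ∈ P.2.image Prod.fst
    · rw [if_pos i2, div_div, div_le_div_iff₀ (by positivity) (by positivity)]; nlinarith
    · rw [if_neg i2, mul_one, div_div, ← sq, div_le_div_iff₀ (by positivity) (by positivity)]; nlinarith
  · have i2 : p ∈ P.2.image Prod.fst := hA'.2 (Or.inl ho2)
    rw [if_pos (hcond.2 (Or.inr ho2)), if_neg ho1, if_pos ho2, if_pos i2]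
    have e : |1 - 0 - (p:ℝ) / ((p:ℝ) - 1) + 0| = 1 / ((p:ℝ) - 1) := by
      rw [sub_zero, add_zero, show 1 - (p:ℝ) / ((p:ℝ) - 1) = -(1 / ((p:ℝ) - 1)) by field_simp; ring,
        abs_neg, abs_of_pos (by positivity)]
    rw [e]
    by_cases i1 : p ∈ P.1.image Prod.fst
    · rw [if_pos i1, div_div, div_le_div_iff₀ (by positivity) (by positivity)]; nlinarith
    · rw [if_neg i1, one_mul, div_div, ← sq, div_le_div_iff₀ (by positivity) (by positivity)]; nlinarith
  · -- in neither off-part: both `m`-parts (the other configurations are good)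
    rw [if_neg (fun h => (hcond.1 h).elim ho1 ho2), abs_one]
    rw [Finset.image_union, Finset.mem_union] at hp
    have hm1 : p ∈ (mPart P.1 m).image Prod.fst ∨ p ∉ P.1.image Prod.fst := by
      by_cases h : p ∈ P.1.image Prod.fst
      · exact Or.inl ((hA.1 h).resolve_left ho1)
      · exact Or.inr h
    have hm2 : p ∈ (mPart P.2 m).image Prod.fst ∨ p ∉ P.2.image Prod.fst := by
      by_cases h : p ∈ P.2.image Prod.fst
      · exact Or.inl ((hA'.1 h).resolve_left ho2)
      · exact Or.inr h
    -- the only bad possibility is `p` in both `m`-parts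
    have i1 : p ∈ P.1.image Prod.fst := by
      rcases hm1 with hm1 | hm1
      · exact hA.2 (Or.inr hm1)
      · rcases hp with hp | hp
        · exact absurd hp hm1
        · rcases hm2 with hm2 | hm2
          · exact absurd (hnm2 hm2) hm1
          · exact absurd hp hm2
    have i2 : p ∈ P.2.image Prod.fst := by
      rcases hm2 with hm2 | hm2
      · exact hA'.2 (Or.inr hm2)
      · have hm1' : p ∈ (mPart P.1 m).image Prod.fst := (hA.1 i1).resolve_left ho1
        exact absurd (hnm1 hm1') hm2
    rw [if_pos i1, if_pos i2, ← sq, div_le_div_iff₀ (by positivity) (by positivity)]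
    nlinarith

end S2Kernel


/-! ### Lemma 5.2/5.3: product form of the weights and the peeling bound for `S₂^{(m)}` -/

section S2Peel

variable {k : ℕ} {D₀ Rn : ℕ} (m : Fin k)

/-- The primes of a pair. [folklore] -/
def primesOf (P : Finset (ℕ × Fin k) × Finset (ℕ × Fin k)) : Finset ℕ := (P.1 ∪ P.2).image Prod.fst

/-- The total weight `|K₂|/(φ(A)φ(A'))` of a pair, in product form. [folklore] -/
noncomputable def W2 (P : Finset (ℕ × Fin k) × Finset (ℕ × Fin k)) : ℝ := ∏ p ∈ primesOf P, locW2 m P p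

/-- `locW2 ≥ 0`. [folklore] -/
theorem locW2_nonneg {P : Finset (ℕ × Fin k) × Finset (ℕ × Fin k)}
    (h1 : P.1 ∈ tuplesProd k D₀ Rn) (h2 : P.2 ∈ tuplesProd k D₀ Rn) (p : ℕ) (hp : p ∈ primesOf P) :
    0 ≤ locW2 m P p := by
  have hpp : p.Prime := by
    obtain ⟨x, hx, rfl⟩ := Finset.mem_image.1 hp
    exact (Finset.mem_union.1 hx).elim (fun h => prime_of_mem_tuples (tuplesProd_subset h1) h)
      (fun h => prime_of_mem_tuples (tuplesProd_subset h2) h)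
  have : (2:ℝ) ≤ p := by exact_mod_cast hpp.two_le
  have hq : 0 < (p:ℝ) - 1 := by linarith
  unfold locW2
  refine div_nonneg (abs_nonneg _) (mul_nonneg ?_ ?_) <;> split_ifs <;> positivity

/-- `W2 ≥ 0`. [folklore] -/
theorem W2_nonneg {P : Finset (ℕ × Fin k) × Finset (ℕ × Fin k)}
    (h1 : P.1 ∈ tuplesProd k D₀ Rn) (h2 : P.2 ∈ tuplesProd k D₀ Rn) : 0 ≤ W2 m P :=
  Finset.prod_nonneg fun p hp => locW2_nonneg m h1 h2 p hp

/-- **Product form**: `|K₂(A∖m, A'∖m)| / (φ(A) φ(A')) = ∏_p locW2 p`. [folklore] -/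
theorem abs_kernel_div_eq_W2 {P : Finset (ℕ × Fin k) × Finset (ℕ × Fin k)}
    (h1 : P.1 ∈ tuplesProd k D₀ Rn) (h2 : P.2 ∈ tuplesProd k D₀ Rn) :
    |kernel (fun p => (p : ℝ) - 1) (offPart P.1 m) (offPart P.2 m)| / (phiA P.1 * phiA P.2) = W2 m P := by
  have hf1 := isFunctional_of_mem_tuples (tuplesProd_subset h1)
  have hf2 := isFunctional_of_mem_tuples (tuplesProd_subset h2)
  set V := primesOf P with hV
  set Vo := (offPart P.1 m ∪ offPart P.2 m).image Prod.fst with hVo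
  have hVoV : Vo ⊆ V := Finset.image_subset_image
    (Finset.union_subset_union (offPart_subset _ _) (offPart_subset _ _))
  have h1V : P.1.image Prod.fst ⊆ V := Finset.image_subset_image Finset.subset_union_left
  have h2V : P.2.image Prod.fst ⊆ V := Finset.image_subset_image Finset.subset_union_right
  -- numerator
  have hK : |kernel (fun p => (p : ℝ) - 1) (offPart P.1 m) (offPart P.2 m)| =
      ∏ p ∈ V, |(if p ∈ Vo then kernelLoc (fun p => (p : ℝ) - 1) (offPart P.1 m) (offPart P.2 m) p else 1)| := by
    rw [kernel_eq_prod_kernelLoc (hf1.subset (offPart_subset _ _)) (hf2.subset (offPart_subset _ _)),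
      Finset.abs_prod, ← hVo]
    rw [show (∏ p ∈ V, |(if p ∈ Vo then kernelLoc (fun p => (p : ℝ) - 1) (offPart P.1 m) (offPart P.2 m) p else 1)|) =
        ∏ p ∈ V, (if p ∈ Vo then |kernelLoc (fun p => (p : ℝ) - 1) (offPart P.1 m) (offPart P.2 m) p| else 1) from
      Finset.prod_congr rfl fun p _ => by split_ifs <;> simp, Finset.prod_ite_mem, Finset.inter_eq_right.2 hVoV]
  -- denominators
  have hφ1 : phiA P.1 = ∏ p ∈ V, (if p ∈ P.1.image Prod.fst then ((p : ℝ) - 1) else 1) := by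
    rw [phiA_eq_prod_image hf1, Finset.prod_ite_mem, Finset.inter_eq_right.2 h1V]
  have hφ2 : phiA P.2 = ∏ p ∈ V, (if p ∈ P.2.image Prod.fst then ((p : ℝ) - 1) else 1) := by
    rw [phiA_eq_prod_image hf2, Finset.prod_ite_mem, Finset.inter_eq_right.2 h2V]
  rw [hK, hφ1, hφ2, ← Finset.prod_mul_distrib, ← Finset.prod_div_distrib]
  rfl

/-! #### Invariance of the local data under removing one prime -/

/-- Removing the pairs at the prime `p₀`. [folklore] -/
def dropPrime (A : Finset (ℕ × Fin k)) (p₀ : ℕ) : Finset (ℕ × Fin k) := A.filter (fun x => x.1 ≠ p₀)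

/-- `dropPrime A p₀ ⊆ A`. [folklore] -/
theorem dropPrime_subset (A : Finset (ℕ × Fin k)) (p₀ : ℕ) : dropPrime A p₀ ⊆ A := Finset.filter_subset _ _

/-- Primes `≠ p₀` survive dropping `p₀`. [folklore] -/
theorem mem_image_fst_filter_ne {S : Finset (ℕ × Fin k)} {p₀ p : ℕ} (hp : p ≠ p₀) :
    p ∈ (S.filter (fun x => x.1 ≠ p₀)).image Prod.fst ↔ p ∈ S.image Prod.fst := by
  simp only [Finset.mem_image, Finset.mem_filter]
  constructor
  · rintro ⟨x, ⟨hx, -⟩, rfl⟩; exact ⟨x, hx, rfl⟩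
  · rintro ⟨x, hx, rfl⟩; exact ⟨x, ⟨hx, hp⟩, rfl⟩

/-- Off-part of `dropPrime`. [folklore] -/
theorem offPart_dropPrime (A : Finset (ℕ × Fin k)) (p₀ : ℕ) :
    offPart (dropPrime A p₀) m = (offPart A m).filter (fun x => x.1 ≠ p₀) := by
  rw [offPart, dropPrime, offPart, Finset.filter_filter, Finset.filter_filter]
  exact Finset.filter_congr fun x _ => and_comm

/-- `m`-part of `dropPrime`. [folklore] -/
theorem mPart_dropPrime (A : Finset (ℕ × Fin k)) (p₀ : ℕ) :
    mPart (dropPrime A p₀) m = (mPart A m).filter (fun x => x.1 ≠ p₀) := by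
  rw [mPart, dropPrime, mPart, Finset.filter_filter, Finset.filter_filter]
  exact Finset.filter_congr fun x _ => and_comm

/-- The primes after dropping `p₀`. [folklore] -/
theorem image_fst_dropPrime (A : Finset (ℕ × Fin k)) (p₀ : ℕ) :
    (dropPrime A p₀).image Prod.fst = (A.image Prod.fst).erase p₀ := by
  ext p
  rw [Finset.mem_erase]
  by_cases hp : p = p₀
  · subst hp
    simp [dropPrime]
  · rw [dropPrime, mem_image_fst_filter_ne hp]; tauto

/-- The local weight at `p ≠ p₀` is unchanged by removing `p₀`. [folklore] -/
theorem locW2_dropPrime {P : Finset (ℕ × Fin k) × Finset (ℕ × Fin k)} {p₀ p : ℕ} (hp : p ≠ p₀) :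
    locW2 m (dropPrime P.1 p₀, dropPrime P.2 p₀) p = locW2 m P p := by
  have e1 : ∀ S : Finset (ℕ × Fin k), (p ∈ (S.filter (fun x => x.1 ≠ p₀)).image Prod.fst) = (p ∈ S.image Prod.fst) :=
    fun S => propext (mem_image_fst_filter_ne hp)
  have eU : offPart (dropPrime P.1 p₀) m ∪ offPart (dropPrime P.2 p₀) m =
      (offPart P.1 m ∪ offPart P.2 m).filter (fun x => x.1 ≠ p₀) := by
    rw [offPart_dropPrime, offPart_dropPrime, Finset.filter_union]
  have eI : offPart (dropPrime P.1 p₀) m ∩ offPart (dropPrime P.2 p₀) m =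
      (offPart P.1 m ∩ offPart P.2 m).filter (fun x => x.1 ≠ p₀) := by
    rw [offPart_dropPrime, offPart_dropPrime, Finset.filter_inter_distrib]
  unfold locW2 kernelLoc
  simp only [eU, eI]
  simp only [offPart_dropPrime]
  simp only [dropPrime, e1]

/-- Good/bad is unchanged at `p ≠ p₀` by removing `p₀`. [folklore] -/
theorem goodPrime_dropPrime {P : Finset (ℕ × Fin k) × Finset (ℕ × Fin k)} {p₀ p : ℕ} (hp : p ≠ p₀) :
    GoodPrime m (dropPrime P.1 p₀, dropPrime P.2 p₀) p ↔ GoodPrime m P p := by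
  have e1 : ∀ S : Finset (ℕ × Fin k), (p ∈ (S.filter (fun x => x.1 ≠ p₀)).image Prod.fst) = (p ∈ S.image Prod.fst) :=
    fun S => propext (mem_image_fst_filter_ne hp)
  have eI : offPart (dropPrime P.1 p₀) m ∩ offPart (dropPrime P.2 p₀) m =
      (offPart P.1 m ∩ offPart P.2 m).filter (fun x => x.1 ≠ p₀) := by
    rw [offPart_dropPrime, offPart_dropPrime, Finset.filter_inter_distrib]
  unfold GoodPrime
  simp only [eI]
  simp only [mPart_dropPrime]
  simp only [dropPrime, e1]

/-! #### The peeling data -/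

/-- A pair is bad if some prime of it is bad. [folklore] -/
def BadPair (P : Finset (ℕ × Fin k) × Finset (ℕ × Fin k)) : Prop := ∃ p ∈ primesOf P, ¬GoodPrime m P p

/-- Decidability. [folklore] -/
instance (P : Finset (ℕ × Fin k) × Finset (ℕ × Fin k)) : Decidable (BadPair m P) := by
  unfold BadPair; infer_instance

/-- The least bad prime (junk `0` if none). [folklore] -/
noncomputable def minBad (P : Finset (ℕ × Fin k) × Finset (ℕ × Fin k)) : ℕ :=
  if h : ((primesOf P).filter (fun p => ¬GoodPrime m P p)).Nonempty then
    ((primesOf P).filter (fun p => ¬GoodPrime m P p)).min' h else 0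

/-- The least bad prime is a bad prime of the pair. [folklore] -/
theorem minBad_spec {P : Finset (ℕ × Fin k) × Finset (ℕ × Fin k)} (hb : BadPair m P) :
    minBad m P ∈ primesOf P ∧ ¬GoodPrime m P (minBad m P) := by
  have hne : ((primesOf P).filter (fun p => ¬GoodPrime m P p)).Nonempty := by
    obtain ⟨p, hp, hbad⟩ := hb
    exact ⟨p, Finset.mem_filter.2 ⟨hp, hbad⟩⟩
  rw [minBad, dif_pos hne]
  exact Finset.mem_filter.1 (Finset.min'_mem _ hne)

/-- The index option of the prime `p` in `A`. [folklore] -/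
noncomputable def idxOpt [NeZero k] (A : Finset (ℕ × Fin k)) (p : ℕ) : Option (Fin k) :=
  if p ∈ A.image Prod.fst then some (idxOf A p) else none

/-- The pairs of a functional `A` at the prime `p`, reconstructed from `idxOpt`. [folklore] -/
def pairsAt (p : ℕ) : Option (Fin k) → Finset (ℕ × Fin k)
  | none => ∅
  | some i => {(p, i)}

/-- The pairs at `p` of a functional finset, from the index option. [folklore] -/
theorem filter_fst_eq_pairsAt [NeZero k] {A : Finset (ℕ × Fin k)} (hA : IsFunctional A) (p : ℕ) :
    A.filter (fun x => x.1 = p) = pairsAt p (idxOpt A p) := by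
  unfold idxOpt
  split_ifs with hp
  · have hmem := pair_idxOf_mem hp
    simp only [pairsAt]
    ext x
    rw [Finset.mem_filter, Finset.mem_singleton]
    constructor
    · rintro ⟨hx, hxp⟩
      exact hA x hx _ hmem (by rw [hxp])
    · rintro rfl; exact ⟨hmem, rfl⟩
  · simp only [pairsAt]
    rw [Finset.filter_eq_empty_iff]
    intro x hx hxp
    exact hp (Finset.mem_image.2 ⟨x, hx, hxp⟩)

/-- `A` is recovered from `dropPrime A p` and its pairs at `p`. [folklore] -/
theorem dropPrime_union_filter (A : Finset (ℕ × Fin k)) (p : ℕ) :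
    dropPrime A p ∪ A.filter (fun x => x.1 = p) = A := by
  rw [dropPrime, Finset.union_comm]; exact Finset.filter_union_filter_not_eq _ A

/-- Peeling for `S₂`: remove the least bad prime from both tuples. [folklore] -/
noncomputable def peel2 (P : Finset (ℕ × Fin k) × Finset (ℕ × Fin k)) :
    Finset (ℕ × Fin k) × Finset (ℕ × Fin k) :=
  (dropPrime P.1 (minBad m P), dropPrime P.2 (minBad m P))

/-- The peeling key: the least bad prime and its index options in `A` and `A'`. [folklore] -/
noncomputable def key2 [NeZero k] (P : Finset (ℕ × Fin k) × Finset (ℕ × Fin k)) :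
    ℕ × Option (Fin k) × Option (Fin k) :=
  (minBad m P, idxOpt P.1 (minBad m P), idxOpt P.2 (minBad m P))

/-- Peeling removes exactly the local weight at the least bad prime. [folklore] -/
theorem W2_eq_mul_W2_peel2 {P : Finset (ℕ × Fin k) × Finset (ℕ × Fin k)} (hb : BadPair m P) :
    W2 m P = locW2 m P (minBad m P) * W2 m (peel2 m P) := by
  obtain ⟨hp₀, _⟩ := minBad_spec m hb
  unfold W2
  rw [← Finset.mul_prod_erase _ _ hp₀]
  congr 1
  have hV : primesOf (peel2 m P) = (primesOf P).erase (minBad m P) := by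
    unfold primesOf peel2
    rw [Finset.image_union, Finset.image_union, image_fst_dropPrime, image_fst_dropPrime,
      Finset.erase_union_distrib]  -- erase distributes over union
  rw [hV]
  refine Finset.prod_congr rfl fun p hp => ?_
  rw [peel2, locW2_dropPrime m (Finset.ne_of_mem_erase hp)]

/-- **Off-pattern bound for `S₂^{(m)}`** (Maynard 2015, (5.22) and (5.26)–(5.27): pairs with a
prime of mismatched local configuration contribute `O(k²/D₀)` of the total): for `D₀ ≥ 24(k+1)²`,
`∑_{bad pairs} |K₂|/(φφ') ≤ (24 (k+1)²/D₀) ∑_{good pairs} |K₂|/(φφ')`.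
[cite: MaynardAnnals2015, proof of Lemmas 5.2–5.3, (5.22), (5.27)] -/
theorem sum_W2_bad_le [NeZero k] (hD : 24 * (k + 1) ^ 2 ≤ D₀) :
    ∑ P ∈ (tuplesProd k D₀ Rn ×ˢ tuplesProd k D₀ Rn).filter (BadPair m), W2 m P ≤
      24 * ((k : ℝ) + 1) ^ 2 / D₀ *
        ∑ P ∈ (tuplesProd k D₀ Rn ×ˢ tuplesProd k D₀ Rn).filter (fun P => ¬BadPair m P), W2 m P := by
  have hD0 : 0 < D₀ := lt_of_lt_of_le (by positivity) hD
  set TT := tuplesProd k D₀ Rn ×ˢ tuplesProd k D₀ Rn with hTT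
  set Kset := primesIoc D₀ Rn ×ˢ (Finset.univ : Finset (Option (Fin k))) ×ˢ
    (Finset.univ : Finset (Option (Fin k))) with hKset
  set c : ℕ × Option (Fin k) × Option (Fin k) → ℝ := fun κ => 3 / ((κ.1 : ℝ) - 1) ^ 2 with hc
  have hmemTT : ∀ {P}, P ∈ TT → P.1 ∈ tuplesProd k D₀ Rn ∧ P.2 ∈ tuplesProd k D₀ Rn :=
    fun hP => Finset.mem_product.1 hP
  have hpeel := sum_filter_le_of_peel TT (BadPair m) (W2 m)
    (fun P hP => W2_nonneg m (hmemTT hP).1 (hmemTT hP).2) Kset c (fun κ _ => by positivity)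
    (key2 m) (peel2 m)
    (by -- key in Kset
      intro P hP hb
      simp only [key2, hKset, Finset.mem_product, Finset.mem_univ, and_true]
      obtain ⟨hp₀, _⟩ := minBad_spec m hb
      obtain ⟨x, hx, hx1⟩ := Finset.mem_image.1 hp₀
      rw [← hx1]
      exact (Finset.mem_union.1 hx).elim
        (fun h => (mem_tuples.1 (tuplesProd_subset (hmemTT hP).1)).1 x h)
        (fun h => (mem_tuples.1 (tuplesProd_subset (hmemTT hP).2)).1 x h))
    (by -- peel stays in TT
      intro P hP _
      exact Finset.mem_product.2 ⟨subset_mem_tuplesProd (hmemTT hP).1 (dropPrime_subset _ _),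
        subset_mem_tuplesProd (hmemTT hP).2 (dropPrime_subset _ _)⟩)
    (by -- weight factorisation with a bad local factor
      intro P hP hb
      rw [W2_eq_mul_W2_peel2 m hb]
      obtain ⟨hp₀, hbad⟩ := minBad_spec m hb
      refine mul_le_mul_of_nonneg_right (locW2_le_of_not_good m (hmemTT hP).1 (hmemTT hP).2 hp₀ hbad) ?_
      exact W2_nonneg m (subset_mem_tuplesProd (hmemTT hP).1 (dropPrime_subset _ _))
        (subset_mem_tuplesProd (hmemTT hP).2 (dropPrime_subset _ _)))
    (by -- injectivity on fibres
      rintro ⟨p₀, o1, o2⟩ _ P ⟨hP, hb, hPk⟩ Q ⟨hQ, hQb, hQk⟩ hPQ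
      simp only [key2, Prod.mk.injEq] at hPk hQk
      obtain ⟨hp, ho1, ho2⟩ := hPk
      obtain ⟨hq, ho1', ho2'⟩ := hQk
      have e1 := congrArg Prod.fst hPQ
      have e2 := congrArg Prod.snd hPQ
      simp only [peel2] at e1 e2
      rw [hp] at e1 e2; rw [hq] at e1 e2
      have hf1 := isFunctional_of_mem_tuples (tuplesProd_subset (hmemTT hP).1)
      have hf2 := isFunctional_of_mem_tuples (tuplesProd_subset (hmemTT hP).2)
      have hg1 := isFunctional_of_mem_tuples (tuplesProd_subset (hmemTT hQ).1)
      have hg2 := isFunctional_of_mem_tuples (tuplesProd_subset (hmemTT hQ).2)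
      have r1 := dropPrime_union_filter P.1 p₀
      have r2 := dropPrime_union_filter Q.1 p₀
      have r3 := dropPrime_union_filter P.2 p₀
      have r4 := dropPrime_union_filter Q.2 p₀
      rw [filter_fst_eq_pairsAt hf1, ← hp, ho1] at r1
      rw [filter_fst_eq_pairsAt hg1, ← hq, ho1'] at r2
      rw [filter_fst_eq_pairsAt hf2, ← hp, ho2] at r3
      rw [filter_fst_eq_pairsAt hg2, ← hq, ho2'] at r4
      rw [hp] at r1 r3; rw [hq] at r2 r4
      exact Prod.ext (by rw [← r1, ← r2, e1]) (by rw [← r3, ← r4, e2]))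
  -- sum of the local constants
  have hcsum : ∑ κ ∈ Kset, c κ ≤ 12 * ((k : ℝ) + 1) ^ 2 / D₀ := by
    rw [Finset.sum_product]
    have inner : ∀ p ∈ primesIoc D₀ Rn,
        ∑ ij ∈ (Finset.univ : Finset (Option (Fin k))) ×ˢ (Finset.univ : Finset (Option (Fin k))), c (p, ij) =
          ((k : ℝ) + 1) ^ 2 * (3 / ((p : ℝ) - 1) ^ 2) := by
      intro p _
      simp only [hc, Finset.sum_const, Finset.card_product, Finset.card_univ, Fintype.card_option,
        Fintype.card_fin, nsmul_eq_mul]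
      push_cast; ring
    rw [Finset.sum_congr rfl inner, ← Finset.mul_sum]
    have hp : ∑ p ∈ primesIoc D₀ Rn, 3 / ((p : ℝ) - 1) ^ 2 ≤ 12 / (D₀ : ℝ) := by
      calc ∑ p ∈ primesIoc D₀ Rn, 3 / ((p : ℝ) - 1) ^ 2
          ≤ ∑ p ∈ primesIoc D₀ Rn, 12 * (1 / (p : ℝ) ^ 2) := by
            refine Finset.sum_le_sum fun p hp => ?_
            have h2 : (2 : ℝ) ≤ p := by exact_mod_cast (mem_primesIoc.1 hp).2.two_le
            rw [mul_one_div, div_le_div_iff₀ (by nlinarith) (by positivity)]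
            nlinarith
        _ ≤ ∑ n ∈ Finset.Ioc D₀ Rn, 12 * (1 / (n : ℝ) ^ 2) :=
            Finset.sum_le_sum_of_subset_of_nonneg (Finset.filter_subset _ _) fun n _ _ => by positivity
        _ = 12 * ∑ n ∈ Finset.Ioc D₀ Rn, 1 / (n : ℝ) ^ 2 := by rw [Finset.mul_sum]
        _ ≤ 12 * (1 / (D₀ : ℝ)) := by gcongr; exact sum_Ioc_one_div_sq_le hD0 Rn
        _ = 12 / (D₀ : ℝ) := by ring
    calc ((k : ℝ) + 1) ^ 2 * ∑ p ∈ primesIoc D₀ Rn, 3 / ((p : ℝ) - 1) ^ 2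
        ≤ ((k : ℝ) + 1) ^ 2 * (12 / (D₀ : ℝ)) := by gcongr
      _ = 12 * ((k : ℝ) + 1) ^ 2 / D₀ := by ring
  have hs : 12 * ((k : ℝ) + 1) ^ 2 / D₀ ≤ 1 / 2 := by
    rw [div_le_iff₀ (by exact_mod_cast hD0)]
    have : (24 * (k + 1) ^ 2 : ℕ) ≤ (D₀ : ℝ) := by exact_mod_cast hD
    push_cast at this
    linarith
  have htot : 0 ≤ ∑ P ∈ TT, W2 m P :=
    Finset.sum_nonneg fun P hP => W2_nonneg m (hmemTT hP).1 (hmemTT hP).2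
  have h1 : ∑ P ∈ TT.filter (BadPair m), W2 m P ≤ 12 * ((k : ℝ) + 1) ^ 2 / D₀ * ∑ P ∈ TT, W2 m P :=
    hpeel.trans (mul_le_mul_of_nonneg_right hcsum htot)
  have h2 := sum_filter_le_of_peel_of_le_half TT (BadPair m) (W2 m)
    (fun P hP => W2_nonneg m (hmemTT hP).1 (hmemTT hP).2) hs h1
  calc _ ≤ 2 * (12 * ((k : ℝ) + 1) ^ 2 / D₀) * ∑ P ∈ TT.filter (fun P => ¬BadPair m P), W2 m P := h2
    _ = _ := by ring

end S2Peel


/-! ### Lemma 5.2/5.3, conclusion: good pairs and the decomposition of `Σ'₂` -/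

section S2Good

variable {k : ℕ} {D₀ Rn : ℕ} (m : Fin k)

/-- **Good pairs** are exactly those with equal off-parts and disjoint `m`-parts (Maynard: the
main term `a_j = r_j` (`j ≠ m`) of Lemma 5.3 together with the free variables `r_m = a`, `s_m = b`).
[cite: MaynardAnnals2015, proof of Lemma 5.3, (5.27)] -/
theorem not_badPair_iff {P : Finset (ℕ × Fin k) × Finset (ℕ × Fin k)}
    (h1 : P.1 ∈ tuplesProd k D₀ Rn) (h2 : P.2 ∈ tuplesProd k D₀ Rn) :
    ¬BadPair m P ↔ offPart P.1 m = offPart P.2 m ∧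
      Disjoint ((mPart P.1 m).image Prod.fst) ((mPart P.2 m).image Prod.fst) := by
  have hf1 := isFunctional_of_mem_tuples (tuplesProd_subset h1)
  have hf2 := isFunctional_of_mem_tuples (tuplesProd_subset h2)
  have hA : ∀ p, p ∈ P.1.image Prod.fst ↔ p ∈ (offPart P.1 m).image Prod.fst ∨ p ∈ (mPart P.1 m).image Prod.fst :=
    fun p => by rw [← Finset.mem_union, image_fst_offPart_union_mPart]
  have hA' : ∀ p, p ∈ P.2.image Prod.fst ↔ p ∈ (offPart P.2 m).image Prod.fst ∨ p ∈ (mPart P.2 m).image Prod.fst :=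
    fun p => by rw [← Finset.mem_union, image_fst_offPart_union_mPart]
  unfold BadPair
  push Not
  constructor
  · intro hgood
    have hV1 : ∀ x ∈ P.1, x.1 ∈ primesOf P := fun x hx =>
      Finset.mem_image.2 ⟨x, Finset.mem_union_left _ hx, rfl⟩
    have hV2 : ∀ x ∈ P.2, x.1 ∈ primesOf P := fun x hx =>
      Finset.mem_image.2 ⟨x, Finset.mem_union_right _ hx, rfl⟩
    -- off-parts agree
    have sub : ∀ (A A' : Finset (ℕ × Fin k)), IsFunctional A →
        (∀ x ∈ offPart A m, x.1 ∈ (offPart A m ∩ offPart A' m).image Prod.fst ∨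
          (x.1 ∈ (mPart A m).image Prod.fst ∧ x.1 ∉ A'.image Prod.fst) ∨
          (x.1 ∈ (mPart A' m).image Prod.fst ∧ x.1 ∉ A.image Prod.fst)) →
        offPart A m ⊆ offPart A' m := by
      intro A A' hA hg x hx
      rcases hg x hx with h | h | h
      · obtain ⟨z, hz, hzx⟩ := Finset.mem_image.1 h
        rw [Finset.mem_inter] at hz
        rw [← hA z (offPart_subset _ _ hz.1) x (offPart_subset _ _ hx) hzx]; exact hz.2
      · exact absurd h.1 (not_mem_mPart_of_mem_offPart m hA (Finset.mem_image.2 ⟨x, hx, rfl⟩))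
      · exact absurd (Finset.mem_image.2 ⟨x, offPart_subset _ _ hx, rfl⟩) h.2
    refine ⟨Finset.Subset.antisymm (sub P.1 P.2 hf1 fun x hx => hgood x.1 (hV1 x (offPart_subset _ _ hx)))
      (sub P.2 P.1 hf2 fun x hx => ?_), ?_⟩
    · rcases hgood x.1 (hV2 x (offPart_subset _ _ hx)) with h | h | h
      · left; rwa [Finset.inter_comm]
      · right; right; exact h
      · right; left; exact h
    · rw [Finset.disjoint_left]
      intro p hp1 hp2
      have i2 : p ∈ P.2.image Prod.fst := (hA' p).2 (Or.inr hp2)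
      have i1 : p ∈ P.1.image Prod.fst := (hA p).2 (Or.inr hp1)
      obtain ⟨x, hx, rfl⟩ := Finset.mem_image.1 hp1
      rcases hgood x.1 (hV1 x (mPart_subset _ _ hx)) with h | h | h
      · obtain ⟨z, hz, hzx⟩ := Finset.mem_image.1 h
        exact not_mem_mPart_of_mem_offPart m hf1
          (Finset.mem_image.2 ⟨z, (Finset.mem_inter.1 hz).1, hzx⟩) hp1
      · exact h.2 i2
      · exact h.2 i1
  · rintro ⟨heq, hdisj⟩ p hp
    unfold GoodPrime
    rw [primesOf, Finset.image_union, Finset.mem_union] at hp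
    rcases hp with hp | hp
    · rcases (hA p).1 hp with ho | hm
      · left; rw [← heq, Finset.inter_self]; exact ho
      · right; left
        refine ⟨hm, fun h' => ?_⟩
        rcases (hA' p).1 h' with ho' | hm'
        · rw [← heq] at ho'; exact not_mem_mPart_of_mem_offPart m hf1 ho' hm
        · exact Finset.disjoint_left.1 hdisj hm hm'
    · rcases (hA' p).1 hp with ho | hm
      · left; rw [heq, Finset.inter_self]; exact ho
      · right; right
        refine ⟨hm, fun h' => ?_⟩
        rcases (hA p).1 h' with ho' | hm'
        · rw [heq] at ho'; exact not_mem_mPart_of_mem_offPart m hf2 ho' hm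
        · exact Finset.disjoint_left.1 hdisj hm' hm

/-- The weight `(p² − p − 1)/(p − 1)³` of a prime of the common off-part (Maynard's
`μ²(r) φ(r)/(g(r) r)` of (6.13)–(6.14), up to the local factor `1 + O(p⁻²)`). [cite: MaynardAnnals2015, (6.13)] -/
noncomputable def wTwo (p : ℕ) : ℝ := ((p : ℝ) ^ 2 - p - 1) / ((p : ℝ) - 1) ^ 3

/-- The weight `1/(p − 1)` of a prime of an `m`-part (Maynard's `μ²(u)/φ(u)` of (6.10)).
[cite: MaynardAnnals2015, (6.10)] -/
noncomputable def wOne (p : ℕ) : ℝ := 1 / ((p : ℝ) - 1)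

/-- The weight of a good pair: `∏_{p ∣ r (off m)} wTwo p · ∏_{p ∣ r_m} wOne p · ∏_{p ∣ s_m} wOne p`.
[cite: MaynardAnnals2015, proof of Lemma 6.3, (6.12)–(6.14)] -/
noncomputable def goodW (P : Finset (ℕ × Fin k) × Finset (ℕ × Fin k)) : ℝ :=
  (∏ p ∈ (offPart P.1 m).image Prod.fst, wTwo p) *
    ((∏ p ∈ (mPart P.1 m).image Prod.fst, wOne p) * ∏ p ∈ (mPart P.2 m).image Prod.fst, wOne p)

/-- `φ(A) = φ(A∖m) φ(A_m)`. [folklore] -/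
theorem phiA_eq_offPart_mul_mPart (A : Finset (ℕ × Fin k)) :
    phiA A = phiA (offPart A m) * phiA (mPart A m) := by
  rw [← phiA_union (disjoint_offPart_mPart A m), offPart_union_mPart]

/-- **The value on good pairs**: `K₂/(φ(A)φ(A')) = goodW` (Maynard 2015, (5.27) and the weights of
(6.12)–(6.14)). [cite: MaynardAnnals2015, proof of Lemma 5.3, (5.27)] -/
theorem kernel_div_eq_goodW {P : Finset (ℕ × Fin k) × Finset (ℕ × Fin k)}
    (h1 : P.1 ∈ tuplesProd k D₀ Rn) (h2 : P.2 ∈ tuplesProd k D₀ Rn) (hgood : ¬BadPair m P) :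
    kernel (fun p => (p : ℝ) - 1) (offPart P.1 m) (offPart P.2 m) / (phiA P.1 * phiA P.2) = goodW m P := by
  have hf1 := isFunctional_of_mem_tuples (tuplesProd_subset h1)
  have hf2 := isFunctional_of_mem_tuples (tuplesProd_subset h2)
  obtain ⟨heq, _⟩ := (not_badPair_iff m h1 h2).1 hgood
  set O := offPart P.1 m with hO
  have hfO : IsFunctional O := hf1.subset (offPart_subset _ _)
  have hpO : ∀ p ∈ O.image Prod.fst, (2:ℝ) ≤ p := fun p hp => by
    obtain ⟨x, hx, rfl⟩ := Finset.mem_image.1 hp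
    exact_mod_cast (prime_of_mem_tuples (tuplesProd_subset h1) (offPart_subset _ _ hx)).two_le
  -- the kernel on equal off-parts
  have hK : kernel (fun p => (p : ℝ) - 1) O O = ∏ p ∈ O.image Prod.fst, (((p : ℝ) ^ 2 - p - 1) / ((p : ℝ) - 1)) := by
    rw [kernel_eq_prod_kernelLoc hfO hfO, Finset.union_idempotent]
    refine Finset.prod_congr rfl fun p hp => ?_
    have hq : (p:ℝ) - 1 ≠ 0 := by have := hpO p hp; linarith
    unfold kernelLoc
    rw [Finset.inter_self, if_pos hp, if_pos hp]
    field_simp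
    ring
  rw [← heq, hK, phiA_eq_offPart_mul_mPart m P.1, phiA_eq_offPart_mul_mPart m P.2, ← heq, ← hO,
    phiA_eq_prod_image hfO, phiA_eq_prod_image (hf1.subset (mPart_subset _ _)),
    phiA_eq_prod_image (hf2.subset (mPart_subset _ _)), goodW, ← hO]
  -- pure algebra on the three products
  have hO0 : ∏ p ∈ O.image Prod.fst, ((p : ℝ) - 1) ≠ 0 :=
    Finset.prod_ne_zero_iff.2 fun p hp => by have := hpO p hp; linarith
  have hM1 : ∏ p ∈ (mPart P.1 m).image Prod.fst, ((p : ℝ) - 1) ≠ 0 :=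
    Finset.prod_ne_zero_iff.2 fun p hp => by
      obtain ⟨x, hx, rfl⟩ := Finset.mem_image.1 hp
      have : (2:ℝ) ≤ x.1 := by exact_mod_cast (prime_of_mem_tuples (tuplesProd_subset h1) (mPart_subset _ _ hx)).two_le
      linarith
  have hM2 : ∏ p ∈ (mPart P.2 m).image Prod.fst, ((p : ℝ) - 1) ≠ 0 :=
    Finset.prod_ne_zero_iff.2 fun p hp => by
      obtain ⟨x, hx, rfl⟩ := Finset.mem_image.1 hp
      have : (2:ℝ) ≤ x.1 := by exact_mod_cast (prime_of_mem_tuples (tuplesProd_subset h2) (mPart_subset _ _ hx)).two_le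
      linarith
  have eTwo : ∏ p ∈ O.image Prod.fst, wTwo p =
      (∏ p ∈ O.image Prod.fst, (((p : ℝ) ^ 2 - p - 1) / ((p : ℝ) - 1))) /
        (∏ p ∈ O.image Prod.fst, ((p : ℝ) - 1)) ^ 2 := by
    rw [← Finset.prod_pow, ← Finset.prod_div_distrib]
    refine Finset.prod_congr rfl fun p hp => ?_
    have hq : (p:ℝ) - 1 ≠ 0 := by have := hpO p hp; linarith
    rw [wTwo]; field_simp
  have eOne : ∀ S : Finset ℕ, ∏ p ∈ S, wOne p = 1 / ∏ p ∈ S, ((p : ℝ) - 1) := fun S => by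
    rw [one_div, ← Finset.prod_inv_distrib]
    exact Finset.prod_congr rfl fun p _ => by rw [wOne, one_div]
  rw [eTwo, eOne, eOne]
  field_simp

/-- On good pairs the absolute weight is the weight. [folklore] -/
theorem W2_eq_goodW [NeZero k] {P : Finset (ℕ × Fin k) × Finset (ℕ × Fin k)}
    (h1 : P.1 ∈ tuplesProd k D₀ Rn) (h2 : P.2 ∈ tuplesProd k D₀ Rn) (hgood : ¬BadPair m P) :
    W2 m P = goodW m P := by
  rw [← abs_kernel_div_eq_W2 m h1 h2, ← kernel_div_eq_goodW m h1 h2 hgood]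
  have hφ : 0 < phiA P.1 * phiA P.2 :=
    mul_pos (phiA_pos fun x hx => prime_of_mem_tuples (tuplesProd_subset h1) hx)
      (phiA_pos fun x hx => prime_of_mem_tuples (tuplesProd_subset h2) hx)
  have hgw : 0 ≤ goodW m P := by
    unfold goodW
    refine mul_nonneg (Finset.prod_nonneg fun p hp => ?_)
      (mul_nonneg (Finset.prod_nonneg fun p hp => ?_) (Finset.prod_nonneg fun p hp => ?_))
    · obtain ⟨x, hx, rfl⟩ := Finset.mem_image.1 hp
      have : (2:ℝ) ≤ x.1 := by exact_mod_cast (prime_of_mem_tuples (tuplesProd_subset h1) (offPart_subset _ _ hx)).two_le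
      have h0 : 0 ≤ (x.1 : ℝ) - 1 := by linarith
      have h3 : 0 ≤ ((x.1 : ℝ) - 1) ^ 3 := pow_nonneg h0 3
      rw [wTwo]; apply div_nonneg <;> nlinarith
    · obtain ⟨x, hx, rfl⟩ := Finset.mem_image.1 hp
      have : (2:ℝ) ≤ x.1 := by exact_mod_cast (prime_of_mem_tuples (tuplesProd_subset h1) (mPart_subset _ _ hx)).two_le
      rw [wOne]; apply div_nonneg <;> nlinarith
    · obtain ⟨x, hx, rfl⟩ := Finset.mem_image.1 hp
      have : (2:ℝ) ≤ x.1 := by exact_mod_cast (prime_of_mem_tuples (tuplesProd_subset h2) (mPart_subset _ _ hx)).two_le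
      rw [wOne]; apply div_nonneg <;> nlinarith
  have hK : 0 ≤ kernel (fun p => (p : ℝ) - 1) (offPart P.1 m) (offPart P.2 m) := by
    have := kernel_div_eq_goodW m h1 h2 hgood
    rw [div_eq_iff hφ.ne'] at this
    rw [this]; positivity
  rw [abs_of_nonneg hK]

/-- **Lemma 5.2 with Lemma 5.3 substituted, in the `y`-variables** (Maynard 2015, (5.25)–(5.27) and
the shape of (6.12)): for `D₀ ≥ 24(k+1)²` and `|y| ≤ Y`,
`|Σ'₂ − ∑_{good (A,A')} y_A y_{A'} goodW(A,A')| ≤ Y² (24(k+1)²/D₀) ∑_{good} goodW`.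
[cite: MaynardAnnals2015, Lemmas 5.2–5.3, (5.25)–(5.27)] -/
theorem abs_mainSum2_sub_good_le [NeZero k] (hD : 24 * (k + 1) ^ 2 ≤ D₀) {y : Finset (ℕ × Fin k) → ℝ}
    {Y : ℝ} (hY0 : 0 ≤ Y) (hY : ∀ A ∈ tuplesProd k D₀ Rn, |y A| ≤ Y) :
    |mainSum2 D₀ Rn y m -
        ∑ P ∈ (tuplesProd k D₀ Rn ×ˢ tuplesProd k D₀ Rn).filter (fun P => ¬BadPair m P),
          y P.1 * y P.2 * goodW m P| ≤
      Y ^ 2 * (24 * ((k : ℝ) + 1) ^ 2 / D₀) *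
        ∑ P ∈ (tuplesProd k D₀ Rn ×ˢ tuplesProd k D₀ Rn).filter (fun P => ¬BadPair m P), goodW m P := by
  set TT := tuplesProd k D₀ Rn ×ˢ tuplesProd k D₀ Rn with hTT
  set t : Finset (ℕ × Fin k) × Finset (ℕ × Fin k) → ℝ := fun P =>
    y P.1 * y P.2 / (phiA P.1 * phiA P.2) * kernel (fun p => (p : ℝ) - 1) (offPart P.1 m) (offPart P.2 m) with ht
  have hmemTT : ∀ {P}, P ∈ TT → P.1 ∈ tuplesProd k D₀ Rn ∧ P.2 ∈ tuplesProd k D₀ Rn :=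
    fun hP => Finset.mem_product.1 hP
  have hsplit : mainSum2 D₀ Rn y m = ∑ P ∈ TT.filter (fun P => ¬BadPair m P), y P.1 * y P.2 * goodW m P +
      ∑ P ∈ TT.filter (BadPair m), t P := by
    rw [mainSum2_eq_sum_kernel, ← Finset.sum_product' (f := fun A A' =>
      y A * y A' / (phiA A * phiA A') * kernel (fun p => (p : ℝ) - 1) (offPart A m) (offPart A' m)), ← hTT,
      ← Finset.sum_filter_add_sum_filter_not TT (fun P => ¬BadPair m P)]
    congr 1
    · refine Finset.sum_congr rfl fun P hP => ?_
      obtain ⟨hP', hg⟩ := Finset.mem_filter.1 hP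
      rw [← kernel_div_eq_goodW m (hmemTT hP').1 (hmemTT hP').2 hg]
      ring
    · exact Finset.sum_congr (Finset.filter_congr fun P _ => by rw [not_not]) fun _ _ => rfl
  rw [hsplit, add_sub_cancel_left]
  calc |∑ P ∈ TT.filter (BadPair m), t P| ≤ ∑ P ∈ TT.filter (BadPair m), |t P| := Finset.abs_sum_le_sum_abs _ _
    _ ≤ ∑ P ∈ TT.filter (BadPair m), Y ^ 2 * W2 m P := by
        refine Finset.sum_le_sum fun P hP => ?_
        obtain ⟨h1, h2⟩ := hmemTT (Finset.mem_filter.1 hP).1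
        have hφ1 := phiA_pos fun x hx => prime_of_mem_tuples (tuplesProd_subset h1) hx
        have hφ2 := phiA_pos fun x hx => prime_of_mem_tuples (tuplesProd_subset h2) hx
        rw [ht]
        dsimp only
        rw [abs_mul, abs_div, abs_mul, abs_mul, abs_of_pos hφ1, abs_of_pos hφ2, ← abs_kernel_div_eq_W2 m h1 h2,
          sq, ← mul_div_assoc, div_mul_eq_mul_div]
        exact div_le_div_of_nonneg_right
          (mul_le_mul_of_nonneg_right (mul_le_mul (hY P.1 h1) (hY P.2 h2) (abs_nonneg _) hY0) (abs_nonneg _))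
          (mul_pos hφ1 hφ2).le
    _ = Y ^ 2 * ∑ P ∈ TT.filter (BadPair m), W2 m P := by rw [Finset.mul_sum]
    _ ≤ Y ^ 2 * (24 * ((k : ℝ) + 1) ^ 2 / D₀ * ∑ P ∈ TT.filter (fun P => ¬BadPair m P), W2 m P) := by
        gcongr; exact sum_W2_bad_le m hD
    _ = Y ^ 2 * (24 * ((k : ℝ) + 1) ^ 2 / D₀) * ∑ P ∈ TT.filter (fun P => ¬BadPair m P), goodW m P := by
        rw [mul_assoc]
        congr 2
        exact Finset.sum_congr rfl fun P hP => W2_eq_goodW m (hmemTT (Finset.mem_filter.1 hP).1).1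
          (hmemTT (Finset.mem_filter.1 hP).1).2 (Finset.mem_filter.1 hP).2

end S2Good

end MaynardTao
end Literature.NumberTheory.Sieve
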